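import Summits.BirchSwinnertonDyer.BirchSwinnertonDyer.Theorems.PrintCf2RamifiedOffTYZMoverBlockFormSixKernel
import HarnessLib

/-!
# Crux `PrintCf2.RamifiedOffTYZOfFacts` (stmt-BirchSwinnertonDyer-20509), line `offtyz-v7`, LEAD cycle 14 (cruxlead-20509 g13):
# THE REGIME-FREE BLOCK FORM ON A BLOCK `d ≡ 6 (mod 8)`, PART II — the bit homomorphism, `#G[2] = 2^{m+1}`, and the involution products

THEOREMS ONLY (no `def`, no named fact, no `sorry`), `--supports stmt-BirchSwinnertonDyer-20509`.  Sequel of `…MoverBlockFormSixKernel`; the block form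
itself is the sequel `…MoverBlockFormSixAll`.

For a block `d = 2q₁⋯q_m ≡ 6 (mod 8)` with a ring class dictionary `ρ` onto a finite abelian group `G` ((RC1), (RC3) as hypotheses; `G = Pic(𝒪₄)`):
* §1 the bit map descends to a homomorphism `B : G → 𝔽₂^{m+1}` (`exists_bitsHom_six`), onto, with kernel the squares (`bitsHom_six_ker_range`); hence
  **`#G[2] = #(G/G²) = 2^{m+1}`** (`natCard_mul_self_eq_one`) — genus theory's «number of genera = number of ambiguous classes» for the order `𝒪₄`,
  obtained here from the displayed dictionary alone.
* §2 (abstract finite abelian group) the involution products `E(v) = κ^{v_∞}∏_j f_j^{v_j}` (`κ² = f_j² = 1`): `E(v+w) = E(v)E(w)`, `B(E(v)) = Σ_j v_j N_j`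
  when `B(κ) = 0`, `B(f_j) = N_j`; and **if the rows `N_j` are independent (`#ker N = 2`) and `#G[2] = 2^{m+1}`, every SQUARE involution is `1` or `κ`**
  (`isSquare_invol_eq_one_or`: `E` is injective, hence onto `G[2]`, and a square value has all `v_j = 0`).
BSD is not proved by any of this; no class is closed by this file.

References: [cite: TianYuanZhang2017, §3.1 (p0011 L1–L13, L60–L64), Prop. 3.2 (2) (p0010 L111–L113), proof of Lemma 3.21 (p0020 L55–L62)];
[cite: Cox2013, §3.B Thm. 3.15, §7.D Thm. 7.24, §9.A (pp. 180–181)]; [cite: Rotman1995, Thm. 2.19 (PDF p. 37)]; [cite: Stevenhagen1995RedeiMatrices, §2].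
-/

noncomputable section

open scoped Classical NumberField

open WeierstrassCurve WeierstrassCurve.Affine Finset Matrix Literature.NumberTheory.EllipticCurves
  Literature.NumberTheory.EllipticCurves.TianYuanZhang2017
  Literature.NumberTheory.EllipticCurves.TianYuanZhang2017.W2
  Literature.NumberTheory.EllipticCurves.HeathBrown1994
  Literature.NumberTheory.EllipticCurves.HeathBrown1994.Families
  Literature.NumberTheory.EllipticCurves.Smith2016
  Literature.NumberTheory.QuadraticFields.RingClass
  Literature.NumberTheory.QuadraticFields
  Summit.BirchSwinnertonDyer.Rank1Residual.P2.GenusPeriodTransferLayer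
  Summit.BirchSwinnertonDyer.PrintCf2.QForm

set_option autoImplicit false

namespace Summit.BirchSwinnertonDyer.PrintCf2.MoverAssembly

variable {n : ℕ} (D : GenusPointData n)
variable {m : ℕ} (q : Fin m → ℕ) (hq : ∀ j, (q j).Prime) (hqodd : ∀ j, Odd (q j)) (hqinj : Function.Injective q)
variable {d : ℕ} {z : APoint D.H} {Φ : Finset (D.H ≃ₐ[ℚ] D.H)} {ΓH ΓH' : Subgroup (D.H ≃ₐ[ℚ] D.H)} {σ c : D.H ≃ₐ[ℚ] D.H}
variable {G : Type*} [CommGroup G] {ρ : D.galK d →* G}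

/-! ## §1 The bit homomorphism on `G` and `#G[2] = 2^{m+1}` -/

include hq hqodd hqinj in
/-- **The bit homomorphism `G → 𝔽₂^{m+1}`**: bits factor through the onto map `ρ` ((RC1), (RC3)), additively.
[cite: TianYuanZhang2017, §3.1 (p0011 L1–L13, L60–L64)] [cite: Cox2013, §9.A, Thm. 6.1] -/
theorem exists_bitsHom_six (hn : Squarefree n) (hd : d ∈ n.divisors) (hprod : 2 * ∏ j, q j = d) (hρ1 : Function.Surjective ρ)
    (hρ3 : ∀ g : D.galK d, D.TrivialOnL d g ↔ ∃ h : D.galK d, (h : D.H ≃ₐ[ℚ] D.H) D.im = D.im ∧ ρ g = ρ h * ρ h) :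
    ∃ B : G →* Multiplicative (Fin m ⊕ Unit → ZMod 2), ∀ a : D.galK d, B (ρ a) = Multiplicative.ofAdd
      (Sum.elim (fun i => if (a : D.H ≃ₐ[ℚ] D.H) (D.im * D.sqrtNeg (q i)) = D.im * D.sqrtNeg (q i) then (0 : ZMod 2) else 1)
        (fun (_ : Unit) => if (a : D.H ≃ₐ[ℚ] D.H) (D.im * D.sqrtNeg 2) = D.im * D.sqrtNeg 2 then (0 : ZMod 2) else 1)) := by
  set x : D.galK d → (Fin m ⊕ Unit → ZMod 2) := fun a =>
    Sum.elim (fun i => if (a : D.H ≃ₐ[ℚ] D.H) (D.im * D.sqrtNeg (q i)) = D.im * D.sqrtNeg (q i) then (0 : ZMod 2) else 1)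
      (fun (_ : Unit) => if (a : D.H ≃ₐ[ℚ] D.H) (D.im * D.sqrtNeg 2) = D.im * D.sqrtNeg 2 then (0 : ZMod 2) else 1) with hx
  have hxmul : ∀ a b, x (a * b) = x a + x b := fun a b => bits_six_mul D q hd hprod a b
  have hxρ : ∀ a b, ρ a = ρ b → x a = x b := fun a b hab => bits_six_eq_of_rho_eq D q hq hqodd hqinj hn hd hprod hρ3 hab
  set s := Function.surjInv hρ1 with hs
  have hsρ : ∀ y, ρ (s y) = y := Function.surjInv_eq hρ1
  refine ⟨MonoidHom.mk' (fun y => Multiplicative.ofAdd (x (s y))) (fun y y' => ?_), fun a => ?_⟩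
  · change Multiplicative.ofAdd (x (s (y * y'))) = Multiplicative.ofAdd (x (s y)) * Multiplicative.ofAdd (x (s y'))
    rw [← ofAdd_add, ← hxmul]
    exact congrArg _ (hxρ _ _ (by rw [hsρ, map_mul, hsρ, hsρ]))
  · change Multiplicative.ofAdd (x (s (ρ a))) = Multiplicative.ofAdd (x a)
    exact congrArg _ (hxρ _ _ (by rw [hsρ]))

include hq hqodd hqinj in
/-- **Kernel and image of the bit homomorphism**: `B y = 1 ⟺ y` is a square ((RC3)); `B` is onto (bit surjectivity).
[cite: TianYuanZhang2017, §3.1 (p0011 L1–L13, L60–L64), proof of Lemma 3.21 (p0020 L55–L58)] [cite: Cox2013, §3.B Thm. 3.15, Thm. 6.1] -/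
theorem bitsHom_six_ker_range (hn : Squarefree n) (hd : d ∈ n.divisors) (hprod : 2 * ∏ j, q j = d) (hρ1 : Function.Surjective ρ)
    (hρ3 : ∀ g : D.galK d, D.TrivialOnL d g ↔ ∃ h : D.galK d, (h : D.H ≃ₐ[ℚ] D.H) D.im = D.im ∧ ρ g = ρ h * ρ h)
    {B : G →* Multiplicative (Fin m ⊕ Unit → ZMod 2)} (hB : ∀ a : D.galK d, B (ρ a) = Multiplicative.ofAdd
      (Sum.elim (fun i => if (a : D.H ≃ₐ[ℚ] D.H) (D.im * D.sqrtNeg (q i)) = D.im * D.sqrtNeg (q i) then (0 : ZMod 2) else 1)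
        (fun (_ : Unit) => if (a : D.H ≃ₐ[ℚ] D.H) (D.im * D.sqrtNeg 2) = D.im * D.sqrtNeg 2 then (0 : ZMod 2) else 1))) :
    (∀ y : G, B y = 1 ↔ IsSquare y) ∧ Function.Surjective B := by
  have hq2 : ∀ j, q j ≠ 2 := fun j h2 => by
    have := hqodd j; rw [h2] at this; exact (Nat.not_odd_iff_even.mpr even_two) this
  constructor
  · intro y
    obtain ⟨a, rfl⟩ := hρ1 y
    rw [hB, isSquare_rho_iff_bits_six_eq_zero D q hq hqodd hqinj hn hd hprod hρ1 hρ3 a]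
    exact ⟨fun h => by simpa using congrArg Multiplicative.toAdd h, fun h => by rw [h]; rfl⟩
  · intro v
    obtain ⟨a, ha⟩ := exists_galK_bits_six_eq D q hq hqinj hd hprod hq2 (Multiplicative.toAdd v)
    exact ⟨ρ a, by rw [hB, ha]; rfl⟩

include hq hqodd hqinj in
/-- **`#G[2] = 2^{m+1}`**: `#G = #G² · #G[2]` (squaring) and `#G = 2^{m+1} · #G²` (the bit homomorphism: onto `𝔽₂^{m+1}`, kernel `G²`).
[cite: Cox2013, §3.B Thm. 3.15 (the number of genera equals `#C/C² = #C[2]`)] [cite: TianYuanZhang2017, §3.1 (p0011 L1–L13)] -/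
theorem natCard_mul_self_eq_one [Finite G] (hn : Squarefree n) (hd : d ∈ n.divisors) (hprod : 2 * ∏ j, q j = d)
    (hρ1 : Function.Surjective ρ)
    (hρ3 : ∀ g : D.galK d, D.TrivialOnL d g ↔ ∃ h : D.galK d, (h : D.H ≃ₐ[ℚ] D.H) D.im = D.im ∧ ρ g = ρ h * ρ h) :
    Nat.card {y : G // y * y = 1} = 2 ^ (m + 1) := by
  obtain ⟨B, hB⟩ := exists_bitsHom_six D q hq hqodd hqinj hn hd hprod hρ1 hρ3
  obtain ⟨hBker, hBsurj⟩ := bitsHom_six_ker_range D q hq hqodd hqinj hn hd hprod hρ1 hρ3 hB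
  -- `#G = #range · #ker` for both homomorphisms
  have h1 : Nat.card G = Nat.card (powMonoidHom (α := G) 2).range * Nat.card (powMonoidHom (α := G) 2).ker := by
    rw [Subgroup.card_eq_card_quotient_mul_card_subgroup (powMonoidHom (α := G) 2).ker]
    congr 1
    exact Nat.card_congr (QuotientGroup.quotientKerEquivRange _).toEquiv
  have h2 : Nat.card G = Nat.card B.range * Nat.card B.ker := by
    rw [Subgroup.card_eq_card_quotient_mul_card_subgroup B.ker]
    congr 1
    exact Nat.card_congr (QuotientGroup.quotientKerEquivRange _).toEquiv
  -- identify the four subgroups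
  have hsqrange : Nat.card (powMonoidHom (α := G) 2).range = Nat.card {y : G // IsSquare y} := by
    refine Nat.card_congr (Equiv.subtypeEquivRight fun y => ?_)
    constructor
    · rintro ⟨w, rfl⟩; exact ⟨w, by rw [powMonoidHom_apply, pow_two]⟩
    · rintro ⟨w, hw⟩; exact ⟨w, by rw [powMonoidHom_apply, pow_two, hw]⟩
  have hsqker : Nat.card (powMonoidHom (α := G) 2).ker = Nat.card {y : G // y * y = 1} :=
    Nat.card_congr (Equiv.subtypeEquivRight fun y => by rw [MonoidHom.mem_ker, powMonoidHom_apply, pow_two])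
  have hBrange : Nat.card B.range = 2 ^ (m + 1) := by
    rw [MonoidHom.range_eq_top.mpr hBsurj, Subgroup.card_top, Nat.card_eq_fintype_card, Fintype.card_multiplicative,
      Fintype.card_fun, ZMod.card, Fintype.card_sum, Fintype.card_fin, Fintype.card_unit]
  have hBker' : Nat.card B.ker = Nat.card {y : G // IsSquare y} :=
    Nat.card_congr (Equiv.subtypeEquivRight fun y => by rw [MonoidHom.mem_ker]; exact hBker y)
  rw [hsqrange, hsqker] at h1
  rw [hBrange, hBker'] at h2
  have hpos : 0 < Nat.card {y : G // IsSquare y} := Nat.card_pos_iff.mpr ⟨⟨⟨1, ⟨1, (mul_one 1).symm⟩⟩⟩, inferInstance⟩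
  have := h1.symm.trans h2
  rw [mul_comm] at this
  exact Nat.eq_of_mul_eq_mul_right hpos this

/-! ## §2 The involution products `κ^ε ∏ f_j^{v_j}` (abstract finite abelian group): with independent rows they exhaust `G[2]`, so the square involutions are `1, κ` -/

section AbstractInvolutions

variable {m : ℕ}

/-- Exponent bookkeeping for an involution `x`: `x^{[u+v=1]} = x^{[u=1]}·x^{[v=1]}` over `𝔽₂`. [folklore] -/
theorem ite_add_eq_one_mul {M : Type*} [Monoid M] {x : M} (hx : x * x = 1) (u v : ZMod 2) :
    (if u + v = 1 then x else 1) = (if u = 1 then x else 1) * (if v = 1 then x else 1) := by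
  have key : ∀ a b : ZMod 2, (a + b = 1 ↔ (a = 1 ↔ ¬ b = 1)) := by decide
  by_cases hu : u = 1 <;> by_cases hv : v = 1
  · rw [if_neg (fun h => ((key u v).mp h).mp hu hv), if_pos hu, if_pos hv, hx]
  · rw [if_pos ((key u v).mpr ⟨fun _ => hv, fun _ => hu⟩), if_pos hu, if_neg hv, mul_one]
  · rw [if_pos ((key u v).mpr ⟨fun h => (hu h).elim, fun h => (h hv).elim⟩), if_neg hu, if_pos hv, one_mul]
  · rw [if_neg (fun h => hu (((key u v).mp h).mpr hv)), if_neg hu, if_neg hv, mul_one]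

/-- **Products of commuting involutions indexed by `𝔽₂^{m+1}` multiply**: `E(v + w) = E(v)·E(w)` for
`E(v) = κ^{v_∞}∏_j f_j^{v_j}` (`κ² = f_j² = 1`). [folklore] -/
theorem invol_prod_add {m : ℕ} {κ : G} {f : Fin m → G} (hκ : κ * κ = 1) (hf : ∀ j, f j * f j = 1)
    (v w : Fin m ⊕ Unit → ZMod 2) :
    ((if (v + w) (Sum.inr ()) = 1 then κ else 1) * ∏ j, (if (v + w) (Sum.inl j) = 1 then f j else 1)) =
      ((if v (Sum.inr ()) = 1 then κ else 1) * ∏ j, (if v (Sum.inl j) = 1 then f j else 1)) *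
        ((if w (Sum.inr ()) = 1 then κ else 1) * ∏ j, (if w (Sum.inl j) = 1 then f j else 1)) := by
  simp only [Pi.add_apply]
  rw [ite_add_eq_one_mul hκ, Finset.prod_congr rfl (fun j _ => ite_add_eq_one_mul (hf j) (v (Sum.inl j)) (w (Sum.inl j))),
    Finset.prod_mul_distrib]
  exact mul_mul_mul_comm _ _ _ _

/-- **Bits of the involution products**: for a homomorphism `B : G → 𝔽₂^{m+1}` with `B(κ) = 0` and `B(f_j) = N_j` (the `j`-th row),
`B(E(v)) = Σ_j v_j N_j`. [folklore] -/
theorem map_invol_prod_eq {m : ℕ} (B : G →* Multiplicative (Fin m ⊕ Unit → ZMod 2))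
    (N : Matrix (Fin m ⊕ Unit) (Fin m ⊕ Unit) (ZMod 2)) {κ : G} {f : Fin m → G} (hBκ : B κ = 1)
    (hBf : ∀ j, B (f j) = Multiplicative.ofAdd (N (Sum.inl j))) (v : Fin m ⊕ Unit → ZMod 2) :
    B ((if v (Sum.inr ()) = 1 then κ else 1) * ∏ j, (if v (Sum.inl j) = 1 then f j else 1)) =
      Multiplicative.ofAdd (∑ j, v (Sum.inl j) • N (Sum.inl j)) := by
  rw [map_mul, map_prod]
  have h1 : B (if v (Sum.inr ()) = 1 then κ else 1) = 1 := by
    split_ifs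
    · exact hBκ
    · exact map_one B
  rw [h1, one_mul, ofAdd_sum]
  refine Finset.prod_congr rfl fun j _ => ?_
  by_cases hj : v (Sum.inl j) = 1
  · rw [if_pos hj, hBf, hj, one_smul]
  · have hj0 : v (Sum.inl j) = 0 := by
      have : ∀ x : ZMod 2, x ≠ 1 → x = 0 := by decide
      exact this _ hj
    rw [if_neg hj, map_one, hj0, zero_smul, ofAdd_zero]

/-- **Independent rows ⟹ the square involutions are `1` and `κ`.**  Let `B : G ↠ 𝔽₂^{m+1}`… precisely: `B : G → 𝔽₂^{m+1}` a homomorphism whose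
kernel is the set of squares, `κ ≠ 1` a square-class-trivial involution (`B κ = 0`), `f_1, …, f_m` involutions whose bits are the first `m` rows of a
square matrix `N` with zero last row and `#ker N = 2` (independent rows), and `#G[2] = 2^{m+1}`.  Then every square `s` with `s² = 1` is `1` or `κ`:
the map `v ↦ κ^{v_∞}∏ f_j^{v_j}` is injective (its bits are `Σ v_j N_j`), hence onto `G[2]`, and a square value has `v_j = 0` for all `j`.
[cite: Rotman1995, Thm. 2.19 (PDF p. 37)] [cite: Stevenhagen1995RedeiMatrices, §2] -/
theorem isSquare_invol_eq_one_or [Finite G] {m : ℕ} (B : G →* Multiplicative (Fin m ⊕ Unit → ZMod 2))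
    (hBker : ∀ y, B y = 1 ↔ IsSquare y) (N : Matrix (Fin m ⊕ Unit) (Fin m ⊕ Unit) (ZMod 2)) (hN : ∀ u, N (Sum.inr u) = 0)
    (hcard : Fintype.card {v : Fin m ⊕ Unit → ZMod 2 // N *ᵥ v = 0} = 2)
    {κ : G} (hκ1 : κ ≠ 1) (hκκ : κ * κ = 1) (hBκ : B κ = 1) {f : Fin m → G} (hf : ∀ j, f j * f j = 1)
    (hBf : ∀ j, B (f j) = Multiplicative.ofAdd (N (Sum.inl j))) (hG2 : Nat.card {y : G // y * y = 1} = 2 ^ (m + 1))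
    (s : G) (hs : IsSquare s) (hs2 : s * s = 1) : s = 1 ∨ s = κ := by
  set E : (Fin m ⊕ Unit → ZMod 2) → G := fun v =>
    (if v (Sum.inr ()) = 1 then κ else 1) * ∏ j, (if v (Sum.inl j) = 1 then f j else 1) with hE
  have hEmul : ∀ v w, E (v + w) = E v * E w := fun v w => by simp only [hE]; exact invol_prod_add hκκ hf v w
  have hE0 : E 0 = 1 := by
    simp only [hE, Pi.zero_apply]
    rw [if_neg (by decide), Finset.prod_eq_one (fun j _ => if_neg (by decide)), mul_one]
  have hEsq : ∀ v, E v * E v = 1 := fun v => by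
    rw [← hEmul, show v + v = 0 from funext fun _ => CharTwo.add_self_eq_zero _, hE0]
  have hBE : ∀ v, B (E v) = Multiplicative.ofAdd (∑ j, v (Sum.inl j) • N (Sum.inl j)) := fun v => by
    simp only [hE]; exact map_invol_prod_eq B N hBκ hBf v
  have hker0 : ∀ v, B (E v) = 1 → (fun j => v (Sum.inl j)) = 0 := fun v h1 =>
    eq_zero_of_sum_smul_row_eq_zero N hN hcard (by rw [hBE] at h1; exact ofAdd_eq_one.mp h1)
  have hEv0 : ∀ v, (fun j => v (Sum.inl j)) = 0 → E v = if v (Sum.inr ()) = 1 then κ else 1 := by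
    intro v hv0
    simp only [hE]
    rw [Finset.prod_eq_one (fun j _ => by rw [show v (Sum.inl j) = 0 from congr_fun hv0 j, if_neg (by decide)]), mul_one]
  have hEinj : Function.Injective E := by
    intro v w hvw
    have h1 : E (v + w) = 1 := by rw [hEmul, hvw, hEsq]
    have hvw0 := hker0 (v + w) (by rw [h1, map_one])
    have hinr : (v + w) (Sum.inr ()) ≠ 1 := fun h1' => hκ1 (by rw [hEv0 _ hvw0, if_pos h1'] at h1; exact h1)
    have e01 : ∀ a b : ZMod 2, a + b = 0 → a = b := by decide
    have ne1 : ∀ a : ZMod 2, a ≠ 1 → a = 0 := by decide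
    funext cc
    rcases cc with j | u
    · exact e01 _ _ (congr_fun hvw0 j)
    · exact e01 _ _ (ne1 _ hinr)
  haveI : Fintype {y : G // y * y = 1} := Fintype.ofFinite _
  have hbij : Function.Bijective (fun v => (⟨E v, hEsq v⟩ : {y : G // y * y = 1})) := by
    refine (Fintype.bijective_iff_injective_and_card _).mpr ⟨fun v w hvw => hEinj (congrArg Subtype.val hvw), ?_⟩
    rw [Fintype.card_fun, ZMod.card, Fintype.card_sum, Fintype.card_fin, Fintype.card_unit, ← Nat.card_eq_fintype_card, hG2]
  obtain ⟨v, hv⟩ := hbij.2 ⟨s, hs2⟩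
  have hvs : E v = s := congrArg Subtype.val hv
  have hv0 := hker0 v (by rw [hvs]; exact (hBker s).mpr hs)
  rw [← hvs, hEv0 v hv0]
  split_ifs
  · exact Or.inr rfl
  · exact Or.inl rfl

end AbstractInvolutions

end Summit.BirchSwinnertonDyer.PrintCf2.MoverAssembly

end
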